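import Summits.BirchSwinnertonDyer.Rank1Residual.X11b.CongruentSelmerTransferLocalLeRat
import Summits.BirchSwinnertonDyer.Rank1Residual.X11b.CongruentSelmerTransferTypedGlue
import Summits.BirchSwinnertonDyer.Rank1Residual.X11b.PadicRootsOfUnityOdd
import Summits.BirchSwinnertonDyer.Rank1Residual.GaloisImage.CongruenceVisibilityPotMult
import Summits.BirchSwinnertonDyer.Rank1Residual.GaloisImage.PadicTwistClassDecider
import Summits.BirchSwinnertonDyer.Rank1Residual.X11a.SelmerCompanionNonsplit
import Summits.BirchSwinnertonDyer.Rank1Residual.X11a.SelmerCompanionNonsplitPartner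
import Summits.BirchSwinnertonDyer.Rank1Residual.Additive.ZpTowerLayerRootsOfUnity
import Summits.BirchSwinnertonDyer.Rank1Residual.AdditivePotMult.RankZeroShaEightyOneCertificateIntModel
import Literature.NumberTheory.EllipticCurves.MazurRubin2015.KummerImageGoodReduction
import Literature.NumberTheory.EllipticCurves.ComplexMultiplicationTwistIsogenyProofs
import HarnessLib

/-!
# Congruent-curve Selmer transfer — ROW-INDEPENDENT GLUE for the ONE-DIRECTIONAL check list (sha-2 GEN 27, staged)

HONEST FRAMING (cell `b2b-bsdres`, verbatim): prove what is provable now; shrink each hard class to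
its core with data; no claim beyond stated classes. EVIDENCE-grade, staged by the sha-2 instrument seat
for ADOPT-AND-FILE by a filing seat; nothing is booked; no named fact; no label moves.

The consumer `X11b/CongruentSelmerTransferLocalLeRat.lean` (`bsdp_of_congruent_*_localLe`) takes, per
place `v` of the finite check set `T` outside `S`, EITHER the Gross–Parson numerals (d1) OR the
one-directional local inclusion (d3) `∀ θ equivariant, c ∈ 𝓢_v(E) → θ_* c ∈ 𝓢_v(Y)` (and for the rules
needing it the converse (u3)). This file packages the tree's KIND LEMMAS in exactly that shape at the
literal place `placeOf q`, with their numeric hypotheses in `decide`/`norm_num` form: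

* **`localLe_of_potMult`** — both curves with `|j|_v > 1` (multiplicative or additive potentially
  multiplicative, ANY residue characteristic incl. `v ∣ p`), same twist class, `μ_p(ℚ_v) = 1`:
  the tree theorem `GaloisImage.TwistedKummer.h1Equiv_mem_selmerLocalKer_of_one_lt_valuation_j`
  (conditional on A41 `hU2`); numerals via `one_lt_valuation_j_placeOf_of_intModel` (`ord_q j < 0`
  from `q^{k+1} ∣ Δ`, `q^{k+1} ∤ c₄³`),
  `twistClass_placeOf` (`sqFlagAt`), `sq_rel_symm` (the converse orientation), `pow_eq_one_imp_placeOf`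
  (`q ≢ 1 mod p`) / `pow_eq_one_imp_placeOf_self` (`q = p` odd, GEN 27 `PadicRootsOfUnityOdd`).
* **`localLe_of_nonsplit_good` / `localLe_of_good_nonsplit`** — `ℓ ≠ 2, p`: one curve non-split
  multiplicative (`γ = −c₄/c₆` not a square in `ℚ_ℓ`, `nonsquare_placeOf`), the other good: the X11a
  theorems `h1Equiv_mem_selmerLocalKer_of_nonsplit_of_good_rat` / `_of_good_of_nonsplit_rat` (A41 `hU`).
* **`localLe_of_good_good_above`** — both curves good at `v ∣ p`, `p` odd: the named fact A308
  `MazurRubin2015.selmerLocalKer_iff_of_goodReduction_above` (hypothesis `hMR`).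
* numeral readers `j_eq_of_intModel`, `neg_c₄_div_c₆_eq_of_intModel`, `hasGoodReductionAt_placeOf_of_not_dvd`.

References: J. H. Silverman, ATAEC (1994) V.5.2–5.4 [SilvermanATAEC1994]; B. Mazur, K. Rubin,
"Selmer companion curves", Trans. AMS 367 (2015) Thm. 3.1 [MazurRubin2015SelmerCompanions];
B. Gross, J. Parson (2012) Lemma 6 [GrossParson2011]; J. Cremona, B. Mazur (2000) §3 [CremonaMazur2000].
-/

set_option autoImplicit false

noncomputable section

open scoped Classical

open Field IsDedekindDomain NumberField Rat.HeightOneSpectrum WeierstrassCurve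
  Literature.NumberTheory.EllipticCurves Literature.NumberTheory.GaloisRepresentations
  Literature.NumberTheory.GaloisCohomology
  Literature.NumberTheory.EllipticCurves.Rank1Residual
  Summit.BirchSwinnertonDyer.BirchSwinnertonDyer.Rank1Residual
  Summit.BirchSwinnertonDyer.Rank1Residual.GaloisImage
open scoped ContRepresentation

namespace Summit.BirchSwinnertonDyer.Rank1Residual.X11b.CongruentTransfer.Records

variable {p : ℕ} [hp : Fact p.Prime]

/-! ## §1 Numeral readers at the literal place `placeOf q` -/

/-- `j(W) = c₄(E₀)³ / Δ(E₀)` read off the integer model. [cite: SilvermanAEC2009, III.1 (p. 42)] -/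
theorem j_eq_of_intModel (W : WeierstrassCurve ℚ) [W.IsElliptic] [W.IsGloballyMinimal]
    {E₀ : WeierstrassCurve ℤ} (hI : integralModelInt W = E₀) {c d : ℤ} (hc : E₀.c₄ = c)
    (hd : E₀.Δ = d) : W.j = (c : ℚ) ^ 3 / (d : ℚ) := by
  rw [j_eq_c₄_pow_div, IntModel.c₄_eq_cast hI, IntModel.Δ_eq_cast hI, hc, hd]

/-- `c₆(W) = c₆(E₀)` in `ℚ`. [folklore] -/
theorem c₆_eq_cast_of_intModel (W : WeierstrassCurve ℚ) [W.IsGloballyMinimal]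
    {E₀ : WeierstrassCurve ℤ} (hI : integralModelInt W = E₀) : W.c₆ = (E₀.c₆ : ℚ) := by
  conv_lhs => rw [← map_integralModelInt W]
  rw [map_c₆, eq_intCast, hI]

/-- `γ(W) = −c₄/c₆ = −(c₄(E₀)/c₆(E₀))` read off the integer model. [cite: SilvermanATAEC1994, V.5.2] -/
theorem neg_c₄_div_c₆_eq_of_intModel (W : WeierstrassCurve ℚ) [W.IsGloballyMinimal]
    {E₀ : WeierstrassCurve ℤ} (hI : integralModelInt W = E₀) {c e : ℤ} (hc : E₀.c₄ = c)
    (he : E₀.c₆ = e) : -(W.c₄ / W.c₆) = -((c : ℚ) / (e : ℚ)) := by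
  rw [IntModel.c₄_eq_cast hI, c₆_eq_cast_of_intModel W hI, hc, he]

/-- **`|j(W)|_v > 1` at `v = placeOf q` from the integer model**: `q^{k+1} ∣ Δ(E₀)` and
`q^{k+1} ∤ c₄(E₀)³` (both `decide` on the literal integers; multiplicative places: `k = 0`;
additive potentially multiplicative places: `k = 3·ord_q c₄`). [cite: SilvermanAEC2009, III.1 (p. 42) and VII.5.1] -/
theorem one_lt_valuation_j_placeOf_of_intModel (W : WeierstrassCurve ℚ) [W.IsElliptic]
    [W.IsGloballyMinimal] {E₀ : WeierstrassCurve ℤ} (hI : integralModelInt W = E₀) (q : ℕ)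
    [Fact q.Prime] (k : ℕ) (hc : ¬ (q : ℤ) ^ (k + 1) ∣ E₀.c₄ ^ 3) (hΔ : (q : ℤ) ^ (k + 1) ∣ E₀.Δ) :
    1 < (placeOf q).valuation ℚ W.j := by
  have hlt := AdditivePotMult.padicValRat_j_lt_zero_of_intModel hI q k hc hΔ
  have hj0 : W.j ≠ 0 := by
    intro h
    rw [h, padicValRat.zero] at hlt
    exact lt_irrefl _ hlt
  exact (TwistedKummer.one_lt_valuation_iff_padicValRat_neg (placeOf q) (primesEquiv_placeOf q)
    hj0).mpr hlt

/-- **Same twist class at `placeOf q`, decided**: `A/B = N/D`, `q^w ∥ N·D`, `sqFlagAt q (N·D) w`.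
[cite: SilvermanATAEC1994, V.5.3] -/
theorem twistClass_placeOf (q : ℕ) [Fact q.Prime] {A B : ℚ} (hB : B ≠ 0) {N D : ℤ} (hD : D ≠ 0)
    (hAB : A / B = (N : ℚ) / (D : ℚ)) {w : ℕ} (hw : (q : ℤ) ^ w ∣ N * D)
    (hw' : ¬ (q : ℤ) ^ (w + 1) ∣ N * D) (hflag : LocalTorsion3At.sqFlagAt q (N * D) w = true) :
    ∃ r : (placeOf q).adicCompletion ℚ, algebraMap ℚ ((placeOf q).adicCompletion ℚ) A =
      r ^ 2 * algebraMap ℚ ((placeOf q).adicCompletion ℚ) B :=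
  LocalTorsion3At.exists_eq_sq_mul_of_sqFlagAt (placeOf q) (primesEquiv_placeOf q) hB hD hAB hw hw'
    hflag

/-- The twist-class relation is symmetric (`a = r² b`, `a ≠ 0` ⇒ `b = (r⁻¹)² a`). [folklore] -/
theorem sq_rel_symm {F : Type*} [Field F] {a b : F} (ha : a ≠ 0) (h : ∃ r : F, a = r ^ 2 * b) :
    ∃ r : F, b = r ^ 2 * a := by
  obtain ⟨r, hr⟩ := h
  have hr0 : r ≠ 0 := by rintro rfl; exact ha (by rw [hr]; ring)
  exact ⟨r⁻¹, by rw [hr]; field_simp⟩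

/-- `ι_v(A) ≠ 0` for `A ≠ 0`. [folklore] -/
theorem algebraMap_adicCompletion_ne_zero (v : HeightOneSpectrum (𝓞 ℚ)) {A : ℚ} (hA : A ≠ 0) :
    algebraMap ℚ (v.adicCompletion ℚ) A ≠ 0 := by
  rw [Ne, map_eq_zero_iff _ (algebraMap ℚ (v.adicCompletion ℚ)).injective]; exact hA

/-- **NOT a square at `placeOf q`, decided** (`sqFlagAt … = false`): the non-split test
`∀ r, ι(γ) ≠ r²`. [cite: SilvermanATAEC1994, V.5.3] -/
theorem nonsquare_placeOf (q : ℕ) [Fact q.Prime] {x : ℚ} {N D : ℤ} (hD : D ≠ 0)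
    (hx : x = (N : ℚ) / (D : ℚ)) {w : ℕ} (hw : (q : ℤ) ^ w ∣ N * D)
    (hw' : ¬ (q : ℤ) ^ (w + 1) ∣ N * D) (hflag : LocalTorsion3At.sqFlagAt q (N * D) w = false) :
    ∀ r : (placeOf q).adicCompletion ℚ, algebraMap ℚ ((placeOf q).adicCompletion ℚ) x ≠ r ^ 2 :=
  fun r h => LocalTorsion3At.not_isSquare_algebraMap_adicCompletion_of_sqFlagAt (placeOf q)
    (primesEquiv_placeOf q) hD hx hw hw' hflag ⟨r, by rw [h, sq]⟩

/-- **`μ_p(ℚ_q) = 1` for `q ≠ p`, `q ≢ 1 (mod p)`** at `placeOf q`. [cite: NeukirchSchmidtWingberg2008, (7.3.10) (p. 400)] -/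
theorem pow_eq_one_imp_placeOf (q : ℕ) [hq : Fact q.Prime] (hpq : p ≠ q) (h1 : ¬ q ≡ 1 [MOD p]) :
    ∀ ζ : (placeOf q).adicCompletion ℚ, ζ ^ p = 1 → ζ = 1 :=
  adicCompletion_pow_eq_one_imp (v := placeOf q) (natCast_not_mem_asIdeal_placeOf hp.out q hpq)
    (by rw [Additive.ZpTower.residueCard_eq_of_prime_mem hq.out (natCast_mem_asIdeal_placeOf q)]
        exact h1)

/-- **`μ_p(ℚ_p) = 1` for `p` odd** at `placeOf p` (GEN 27 `PadicRootsOfUnityOdd`). [cite: Serre1973, Ch. II §3 Thm. 2 (ℚ_p^× ≅ ℤ × ℤ_p × ℤ/(p−1) for p ≠ 2, so μ_p(ℚ_p) = 1)] -/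
theorem pow_eq_one_imp_placeOf_self (hp2 : p ≠ 2) :
    ∀ ζ : (placeOf p).adicCompletion ℚ, ζ ^ p = 1 → ζ = 1 :=
  adicCompletion_rat_pow_eq_one_imp_eq_one_above hp2 (placeOf p) (primesEquiv_placeOf p)

/-- **Good reduction at `placeOf ℓ`** from `ℓ ∤ Δ(E₀)`. [cite: SilvermanAEC2009, VII.5.1(a)] -/
theorem hasGoodReductionAt_placeOf_of_not_dvd (W : WeierstrassCurve ℚ) [W.IsElliptic]
    [W.IsGloballyMinimal] {E₀ : WeierstrassCurve ℤ} (hI : integralModelInt W = E₀) (ℓ : ℕ)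
    [hℓ : Fact ℓ.Prime] (h : ¬ (ℓ : ℤ) ∣ E₀.Δ) : W.HasGoodReductionAt (placeOf ℓ) := by
  haveI := Fact.mk (primesEquiv (placeOf ℓ)).2
  have h' : ¬ ((((primesEquiv (placeOf ℓ) : Nat.Primes) : ℕ) : ℤ)) ∣ W.minimalDiscriminantInt := by
    rw [primesEquiv_placeOf, IntModel.minimalDiscriminantInt_eq hI]; exact h
  exact (hasGoodReductionAtPrime_iff_hasGoodReductionAt_ringOfIntegers (W := W)
    (v := placeOf ℓ)).mp (hasGoodReductionAtPrime_of_not_dvd W _ h')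

/-! ## §2 The kind lemmas in the (d3)/(u3) shape of the consumer -/

/-- **(d3) at a place where both curves have `|j|_v > 1` and the same twist class, `μ_p(ℚ_v) = 1`**
(kind (iii′), any residue characteristic incl. `v ∣ p`; conditional on A41 `hU2`).
[cite: SilvermanATAEC1994, Ch. V Lemma 5.2 (c), Thm. 5.3, Cor. 5.4] [cite: CremonaMazur2000, §3] -/
theorem localLe_of_potMult (hU2 : Silverman1994_thmV53_corV54_tateUniformisation.{0}) (hp2 : p ≠ 2)
    (W Y : WeierstrassCurve ℚ) [W.IsElliptic] [Y.IsElliptic] (v : HeightOneSpectrum (𝓞 ℚ))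
    (hWj : 1 < v.valuation ℚ W.j) (hYj : 1 < v.valuation ℚ Y.j)
    (hγ : ∃ r : v.adicCompletion ℚ, algebraMap ℚ (v.adicCompletion ℚ) (-(Y.c₄ / Y.c₆)) =
      r ^ 2 * algebraMap ℚ (v.adicCompletion ℚ) (-(W.c₄ / W.c₆)))
    (hμ : ∀ ζ : v.adicCompletion ℚ, ζ ^ p = 1 → ζ = 1) :
    ∀ (θ : geomTorsion W (p : ℤ) ≃+ geomTorsion Y (p : ℤ))
      (hθ : ∀ (σ : absoluteGaloisGroup ℚ) (P : geomTorsion W (p : ℤ)), θ (σ • P) = σ • θ P)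
      (c : galoisCohomology (W.torsionGaloisModule (p : ℤ)) 1),
      c ∈ selmerLocalKer W (v.adicCompletion ℚ) (p : ℤ) →
        h1Equiv θ hθ c ∈ selmerLocalKer Y (v.adicCompletion ℚ) (p : ℤ) :=
  fun θ hθ _ hc => TwistedKummer.h1Equiv_mem_selmerLocalKer_of_one_lt_valuation_j Y v hU2 hp2 W θ hθ
    hYj hWj hγ hμ hc

/-- **(d3) at an odd prime `ℓ ≠ p` where `W` is NON-SPLIT multiplicative and `Y` good** (kind (iv);
conditional on A41 `hU`). [cite: SilvermanATAEC1994, Ch. V Thm. 5.3, Cor. 5.4, Ex. 5.11]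
[cite: GrossLMS1991, §7 (7.1)] -/
theorem localLe_of_nonsplit_good (hU : Silverman1994_thmV53_corV54_tateUniformisation.{0})
    (hp2 : p ≠ 2) (W Y : WeierstrassCurve ℚ) [W.IsElliptic] [W.IsGloballyMinimal] [Y.IsElliptic]
    (ℓ : ℕ) [Fact ℓ.Prime] (hℓ2 : ℓ ≠ 2) (hpℓ : p ≠ ℓ) (hmult : W.HasMultiplicativeReductionAtPrime ℓ)
    (hγ : ∀ r : (placeOf ℓ).adicCompletion ℚ,
      algebraMap ℚ ((placeOf ℓ).adicCompletion ℚ) (-(W.c₄ / W.c₆)) ≠ r ^ 2)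
    (hY : Y.HasGoodReductionAt (placeOf ℓ)) :
    ∀ (θ : geomTorsion W (p : ℤ) ≃+ geomTorsion Y (p : ℤ))
      (hθ : ∀ (σ : absoluteGaloisGroup ℚ) (P : geomTorsion W (p : ℤ)), θ (σ • P) = σ • θ P)
      (c : galoisCohomology (W.torsionGaloisModule (p : ℤ)) 1),
      c ∈ selmerLocalKer W ((placeOf ℓ).adicCompletion ℚ) (p : ℤ) →
        h1Equiv θ hθ c ∈ selmerLocalKer Y ((placeOf ℓ).adicCompletion ℚ) (p : ℤ) :=
  fun θ hθ _ hc => X11a.SelmerCompanion.h1Equiv_mem_selmerLocalKer_of_nonsplit_of_good_rat W Y p hU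
    hp2 θ hθ hℓ2 (natCast_mem_asIdeal_placeOf ℓ) hmult hγ hY
    (natCast_not_mem_asIdeal_placeOf hp.out ℓ hpℓ) hc

/-- **(d3) at an odd prime `ℓ ≠ p` where `W` is good and `Y` NON-SPLIT multiplicative** (kind (vi);
conditional on A41 `hU`). [cite: SilvermanATAEC1994, Ch. V Thm. 5.3, Cor. 5.4, Ex. 5.11]
[cite: GrossLMS1991, §7 (7.1)] [cite: MilneADT2006, Ch. I Prop. 3.8] -/
theorem localLe_of_good_nonsplit (hU : Silverman1994_thmV53_corV54_tateUniformisation.{0})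
    (hp2 : p ≠ 2) (W Y : WeierstrassCurve ℚ) [W.IsElliptic] [Y.IsElliptic] [Y.IsGloballyMinimal]
    (ℓ : ℕ) [Fact ℓ.Prime] (hℓ2 : ℓ ≠ 2) (hpℓ : p ≠ ℓ) (hW : W.HasGoodReductionAt (placeOf ℓ))
    (hmult : Y.HasMultiplicativeReductionAtPrime ℓ)
    (hγ : ∀ r : (placeOf ℓ).adicCompletion ℚ,
      algebraMap ℚ ((placeOf ℓ).adicCompletion ℚ) (-(Y.c₄ / Y.c₆)) ≠ r ^ 2) :
    ∀ (θ : geomTorsion W (p : ℤ) ≃+ geomTorsion Y (p : ℤ))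
      (hθ : ∀ (σ : absoluteGaloisGroup ℚ) (P : geomTorsion W (p : ℤ)), θ (σ • P) = σ • θ P)
      (c : galoisCohomology (W.torsionGaloisModule (p : ℤ)) 1),
      c ∈ selmerLocalKer W ((placeOf ℓ).adicCompletion ℚ) (p : ℤ) →
        h1Equiv θ hθ c ∈ selmerLocalKer Y ((placeOf ℓ).adicCompletion ℚ) (p : ℤ) :=
  fun θ hθ _ hc => X11a.SelmerCompanion.h1Equiv_mem_selmerLocalKer_of_good_of_nonsplit_rat W Y p hU
    hp2 θ hθ hℓ2 (natCast_mem_asIdeal_placeOf ℓ) hW hmult hγ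
    (natCast_not_mem_asIdeal_placeOf hp.out ℓ hpℓ) hc

/-- **(d3) at the place over `p` (odd) where BOTH curves are good** — the named fact A308
(Mazur–Rubin 2015 Thm. 3.1 (iv)(b), `e = 1 < p − 1`), hypothesis `hMR`.
[cite: MazurRubin2015SelmerCompanions, Thm. 3.1 (iv)(b) and §6 proof Case 5] -/
theorem localLe_of_good_good_above (hMR : MazurRubin2015.selmerLocalKer_iff_of_goodReduction_above)
    (hp2 : p ≠ 2) (W Y : WeierstrassCurve ℚ) [W.IsElliptic] [Y.IsElliptic]
    (hW : W.HasGoodReductionAt (placeOf p)) (hY : Y.HasGoodReductionAt (placeOf p)) :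
    ∀ (θ : geomTorsion W (p : ℤ) ≃+ geomTorsion Y (p : ℤ))
      (hθ : ∀ (σ : absoluteGaloisGroup ℚ) (P : geomTorsion W (p : ℤ)), θ (σ • P) = σ • θ P)
      (c : galoisCohomology (W.torsionGaloisModule (p : ℤ)) 1),
      c ∈ selmerLocalKer W ((placeOf p).adicCompletion ℚ) (p : ℤ) →
        h1Equiv θ hθ c ∈ selmerLocalKer Y ((placeOf p).adicCompletion ℚ) (p : ℤ) :=
  fun θ hθ c hc => (MazurRubin2015.selmerLocalKer_iff_of_goodReduction_above_rat hMR Y W hp2 θ hθ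
    (placeOf p) (natCast_mem_asIdeal_placeOf p) hY hW c).mp hc

end Summit.BirchSwinnertonDyer.Rank1Residual.X11b.CongruentTransfer.Records

end
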